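import Mathlib
import Literature.Analysis.FluidPDE.LocalTypeI
import HarnessLib

/-!
# Route RootDecompLitSlice — complement to brick B5 of the aside D₁ `DarkBallSpreads`
  (stmt-NavierStokesRegularity-29566, the registered stub `stub_darkBallSpreads` of crux D `NoDarkBall`
  stmt-NavierStokesRegularity-29563): **closed codimension-two-null sets do not separate; the singular
  slice is closed**

Brick B5 of the census ledger (row E20) — «a closed `ℋ¹`-null set does not separate `ℝ³`» — was landed by
the census instrument in `Theorems/RootDecompLitSliceDarkBallSpreadsNullSetComplementConnected.lean`
(`isPathConnected_compl_of_hausdorffMeasure_eq_zero`, coordinate-plane proof; its D₁-facing corollary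
`isPathConnected_compl_terminal_backwardSingularSlice_of_isClosed` takes the CLOSEDNESS of the singular
slice as a hypothesis). This file supplies the two missing pieces and the sharp form, without restating:

* `isClosed_backwardSingularSlice` — for every velocity field `u` and time `t` the backward-singular slice
  `Σ_t = {x | IsBackwardSingularPoint u (t, x)}` is closed (if `u ∈ L^∞(Q_r(t, x))` then
  `u ∈ L^∞(Q_{r/2}(t, x'))` for `dist x' x < r/2`, since `Q_{r/2}(t, x') ⊆ Q_r(t, x)`); this discharges
  the hypothesis `hclosed` of the census corollary;
* `isPathConnected_compl_backwardSingularSlice_of_hausdorffMeasure_eq_zero` — `ℋ¹(Σ_t) = 0 ⟹ Σ_tᶜ`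
  path-connected, nullity being the ONLY hypothesis (plug brick B0
  `hausdorffMeasure_terminal_backwardSingularSlice_eq_zero` of
  `Theorems/RootDecompLitSliceDarkBallSpreadsTerminalSliceNullity.lean`; not imported here so that this
  file stays outside the Theses cone);
* the general separation lemma `isPathConnected_compl_of_isClosed_of_hausdorffMeasure_eq_zero`: in a
  real inner product space `E` with `finrank ℝ E = n + 1`, a closed set `S` with `μH[n] S = 0` has
  path-connected complement (any two points of `Sᶜ` are joined by a three-segment polygon in `Sᶜ`,
  `joinedIn_compl_of_isClosed_of_hausdorffMeasure_eq_zero`), and its sharp `ℝ³` instance under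
  `ℋ²(S) = 0` (`isPathConnected_compl_of_isClosed_of_hausdorffMeasure_two_eq_zero`) — the natural
  non-separation threshold, of which the `ℋ¹` form is the special case `μH[2] ≤ μH[1]`.

Proof of the separation lemma (projection argument): for `x, y ∉ S`, `x ≠ y`, let `K = (ℝ ∙ (y - x))ᗮ`
and `P` the orthogonal projection onto `K` (`1`-Lipschitz, so `μH[n] (P '' S) ≤ μH[n] S = 0`, Mathlib
`hausdorffMeasure_orthogonalProjectionOnto_le`). On the `n`-dimensional space `K`, `μH[n]` is an
additive Haar measure (Mathlib `isAddHaarMeasure_hausdorffMeasure`), hence positive on balls, so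
arbitrarily close to `P x` there is `h ∈ K \ P '' S`. Translating `x, y` by `w = h - P x` (small, so
inside balls around `x`, `y` contained in the open set `Sᶜ`) gives `x', y'` with `P x' = P y' = h`;
the whole segment `[x', y']` projects to `h ∉ P '' S`, so it misses `S`, and `x → x' → y' → y` is a
path in `Sᶜ`.

Sources: Caffarelli–Kohn–Nirenberg 1982 §6 (structure of the singular set, `𝒫¹(S) = 0`); the
non-separation of space by closed sets of zero codimension-one Hausdorff measure is classical geometric
measure theory (Mattila 1995, *Geometry of Sets and Measures in Euclidean Spaces*, Ch. 7, projections;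
Hurewicz–Wallman 1941 Thm VII.3 for the dimension-theoretic form); Mathlib has the countable case
`Set.Countable.isPathConnected_compl_of_one_lt_rank` only. HONEST FRAMING: elementary; closes no item;
nothing here bears on NS regularity (rung 0). Lands `--supports stmt-NavierStokesRegularity-29566`
(decomp-ns route-writer g15).
-/

set_option linter.dupNamespace false
set_option linter.style.longLine false

noncomputable section

open MeasureTheory Set Metric Module
open scoped ENNReal

namespace Summit.NavierStokesRegularity.NavierStokesRegularity.Theorems

section Separation

variable {E : Type*} [NormedAddCommGroup E] [InnerProductSpace ℝ E] [FiniteDimensional ℝ E]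
  [MeasurableSpace E] [BorelSpace E]

/-- **A closed `μH[n]`-null set in an `(n+1)`-dimensional Euclidean space does not separate any two
points of its complement**: they are joined by a path (a three-segment polygon) inside the complement.
[cite: Mattila1995, Ch. 7 (projections decrease Hausdorff measure); folklore GMT] -/
theorem joinedIn_compl_of_isClosed_of_hausdorffMeasure_eq_zero {n : ℕ} [Fact (finrank ℝ E = n + 1)]
    {S : Set E} (hS : IsClosed S) (hnull : μH[(n : ℝ)] S = 0) {x y : E} (hx : x ∉ S) (hy : y ∉ S) :
    JoinedIn Sᶜ x y := by
  classical
  rcases eq_or_ne x y with rfl | hxy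
  · exact JoinedIn.refl hx
  -- the direction `v = y - x` and the hyperplane `K = v^⊥`
  set v : E := y - x with hv_def
  have hv : v ≠ 0 := sub_ne_zero.2 (Ne.symm hxy)
  set K : Submodule ℝ E := (ℝ ∙ v)ᗮ with hK_def
  have hKn : finrank ℝ K = n := Submodule.finrank_orthogonal_span_singleton hv
  set P : E →L[ℝ] K := K.orthogonalProjectionOnto with hP_def
  have hPv : P v = 0 := by
    rw [hP_def, Submodule.orthogonalProjectionOnto_eq_zero_iff]
    exact Submodule.le_orthogonal_orthogonal _ (Submodule.mem_span_singleton_self v)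
  -- the shadow `P '' S` is `μH[n]`-null in `K`
  have hPS : μH[(n : ℝ)] (P '' S) = 0 :=
    nonpos_iff_eq_zero.1 ((hausdorffMeasure_orthogonalProjectionOnto_le K (n : ℝ) S
      (Nat.cast_nonneg n)).trans hnull.le)
  -- balls around `x` and `y` inside the open set `Sᶜ`
  obtain ⟨δ₁, hδ₁, hball₁⟩ := Metric.isOpen_iff.1 hS.isOpen_compl x hx
  obtain ⟨δ₂, hδ₂, hball₂⟩ := Metric.isOpen_iff.1 hS.isOpen_compl y hy
  set δ : ℝ := min δ₁ δ₂ with hδ_def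
  have hδ : 0 < δ := lt_min hδ₁ hδ₂
  -- `μH[n]` is a Haar measure on the `n`-dimensional space `K`, so the shadow misses a point of
  -- every ball: pick `h ∈ ball (P x) δ \ P '' S`
  have hpos : 0 < (μH[(n : ℝ)] : Measure K) (ball (P x) δ) := by
    have h := (isOpen_ball : IsOpen (ball (P x) δ)).measure_pos (μH[(finrank ℝ K : ℝ)] : Measure K)
      ⟨P x, mem_ball_self hδ⟩
    rwa [hKn] at h
  have hnot : ¬ (ball (P x) δ ⊆ P '' S) := fun hsub =>
    hpos.ne' (measure_mono_null hsub hPS)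
  obtain ⟨h, hhball, hhS⟩ := Set.not_subset.1 hnot
  -- the translation vector `w = h - P x`, of norm `< δ`
  set w : E := (h : E) - (P x : E) with hw_def
  have hw_norm : ‖w‖ < δ := by
    have h1 : ‖h - P x‖ < δ := by rwa [mem_ball, dist_eq_norm] at hhball
    rwa [Submodule.coe_norm, Submodule.coe_sub] at h1
  have hPw : P w = h - P x := by
    rw [hw_def, map_sub, Submodule.orthogonalProjectionOnto_mem_subspace_eq_self,
      Submodule.orthogonalProjectionOnto_mem_subspace_eq_self]
  set x' : E := x + w with hx'_def
  set y' : E := y + w with hy'_def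
  have hPx' : P x' = h := by
    rw [hx'_def, map_add, hPw, add_sub_cancel]
  have hy'x' : y' - x' = v := by
    rw [hx'_def, hy'_def, hv_def, add_sub_add_right_eq_sub]
  -- `x'` and `y'` lie in the balls around `x` and `y`
  have hx'ball : x' ∈ ball x δ₁ := by
    rw [mem_ball, dist_eq_norm, hx'_def, add_sub_cancel_left]
    exact hw_norm.trans_le (min_le_left _ _)
  have hy'ball : y' ∈ ball y δ₂ := by
    rw [mem_ball, dist_eq_norm, hy'_def, add_sub_cancel_left]
    exact hw_norm.trans_le (min_le_right _ _)
  -- the segment `[x', y']` misses `S`: it projects onto the single point `h ∉ P '' S`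
  have hseg : segment ℝ x' y' ⊆ Sᶜ := by
    intro z hz hzS
    rw [segment_eq_image'] at hz
    obtain ⟨θ, -, rfl⟩ := hz
    apply hhS
    refine ⟨x' + θ • (y' - x'), hzS, ?_⟩
    rw [map_add, map_smul, hy'x', hPv, smul_zero, add_zero, hPx']
  -- three segments: `x → x'` in `ball x δ₁`, `x' → y'` along the segment, `y' → y` in `ball y δ₂`
  have j₁ : JoinedIn Sᶜ x x' :=
    (((convex_ball x δ₁).isPathConnected ⟨x, mem_ball_self hδ₁⟩).joinedIn x (mem_ball_self hδ₁)
      x' hx'ball).mono hball₁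
  have j₂ : JoinedIn Sᶜ x' y' :=
    (((convex_segment x' y').isPathConnected ⟨x', left_mem_segment ℝ x' y'⟩).joinedIn x'
      (left_mem_segment ℝ x' y') y' (right_mem_segment ℝ x' y')).mono hseg
  have j₃ : JoinedIn Sᶜ y' y :=
    (((convex_ball y δ₂).isPathConnected ⟨y, mem_ball_self hδ₂⟩).joinedIn y' hy'ball
      y (mem_ball_self hδ₂)).mono hball₂
  exact (j₁.trans j₂).trans j₃

/-- A `μH[n]`-null set in an `(n+1)`-dimensional Euclidean space has nonempty complement
(`μH[n+1]` is a Haar measure on `E`). [folklore] -/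
theorem nonempty_compl_of_hausdorffMeasure_eq_zero {n : ℕ} [Fact (finrank ℝ E = n + 1)]
    {S : Set E} (hnull : μH[(n : ℝ)] S = 0) : Sᶜ.Nonempty := by
  rw [Set.nonempty_compl]
  intro hSu
  have hE : finrank ℝ E = n + 1 := Fact.out
  have hpos : 0 < (μH[(finrank ℝ E : ℝ)] : Measure E) univ :=
    isOpen_univ.measure_pos _ univ_nonempty
  have hle : (μH[(finrank ℝ E : ℝ)] : Measure E) univ ≤ μH[(n : ℝ)] univ :=
    Measure.hausdorffMeasure_mono (by rw [hE]; push_cast; linarith) _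
  rw [← hSu] at hpos hle
  exact hpos.ne' (nonpos_iff_eq_zero.1 (hle.trans hnull.le))

/-- **A closed `μH[n]`-null subset of an `(n+1)`-dimensional Euclidean space has path-connected
complement.** [cite: Mattila1995, Ch. 7; folklore GMT] -/
theorem isPathConnected_compl_of_isClosed_of_hausdorffMeasure_eq_zero {n : ℕ}
    [Fact (finrank ℝ E = n + 1)] {S : Set E} (hS : IsClosed S) (hnull : μH[(n : ℝ)] S = 0) :
    IsPathConnected Sᶜ := by
  rw [isPathConnected_iff]
  exact ⟨nonempty_compl_of_hausdorffMeasure_eq_zero hnull, fun x hx y hy =>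
    joinedIn_compl_of_isClosed_of_hausdorffMeasure_eq_zero hS hnull hx hy⟩

/-- Connected form of the previous statement. [this file] -/
theorem isConnected_compl_of_isClosed_of_hausdorffMeasure_eq_zero {n : ℕ}
    [Fact (finrank ℝ E = n + 1)] {S : Set E} (hS : IsClosed S) (hnull : μH[(n : ℝ)] S = 0) :
    IsConnected Sᶜ :=
  (isPathConnected_compl_of_isClosed_of_hausdorffMeasure_eq_zero hS hnull).isConnected

end Separation

section R3

/-- `finrank ℝ ℝ³ = 2 + 1`, the instance shape used by the separation lemma. [folklore] -/
theorem fact_finrank_euclideanSpace_fin_three :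
    Fact (finrank ℝ (EuclideanSpace ℝ (Fin 3)) = 2 + 1) := ⟨by simp⟩

/-- **Sharp `ℝ³` form: a closed `ℋ²`-null set `S ⊆ ℝ³` does not separate `ℝ³`** — its complement is
path-connected. (The `ℋ¹` form, `isPathConnected_compl_of_hausdorffMeasure_eq_zero` of the census file
`RootDecompLitSliceDarkBallSpreadsNullSetComplementConnected`, is the special case `μH[2] ≤ μH[1]`.)
[cite: Mattila1995, Ch. 7] [folklore GMT] -/
theorem isPathConnected_compl_of_isClosed_of_hausdorffMeasure_two_eq_zero
    {S : Set (EuclideanSpace ℝ (Fin 3))} (hS : IsClosed S) (hnull : μH[2] S = 0) :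
    IsPathConnected Sᶜ := by
  haveI := fact_finrank_euclideanSpace_fin_three
  have h2 : μH[((2 : ℕ) : ℝ)] S = 0 := by exact_mod_cast hnull
  exact isPathConnected_compl_of_isClosed_of_hausdorffMeasure_eq_zero (n := 2) hS h2

/-- Pairwise form in `ℝ³`: two points off a closed `ℋ²`-null set are joined by a path avoiding it.
[this file] -/
theorem joinedIn_compl_of_isClosed_of_hausdorffMeasure_two_eq_zero
    {S : Set (EuclideanSpace ℝ (Fin 3))} (hS : IsClosed S) (hnull : μH[2] S = 0)
    {x y : EuclideanSpace ℝ (Fin 3)} (hx : x ∉ S) (hy : y ∉ S) : JoinedIn Sᶜ x y :=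
  (isPathConnected_compl_of_isClosed_of_hausdorffMeasure_two_eq_zero hS hnull).joinedIn x hx y hy

/-- `ℋ¹`-null sets in `ℝ³` are `ℋ²`-null (`μH[2] ≤ μH[1]`). [folklore] -/
theorem hausdorffMeasure_two_eq_zero_of_one {S : Set (EuclideanSpace ℝ (Fin 3))} (hnull : μH[1] S = 0) :
    μH[2] S = 0 :=
  nonpos_iff_eq_zero.1 ((Measure.hausdorffMeasure_mono (by norm_num) S).trans hnull.le)

end R3

/-! ## NS corollary: the regular region of the terminal slice is open and path-connected -/

section Terminal

open Literature.Analysis.FluidPDE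

/-- The backward-singular set `Σ_t = {x | IsBackwardSingularPoint u (t, x)}` of any time slice is
closed: if `u` is essentially bounded on `Q_r(t, x)` then it is on `Q_{r/2}(t, x') ⊆ Q_r(t, x)` for
`dist x' x < r/2`. [folklore] -/
theorem isClosed_backwardSingularSlice (u : ℝ → (EuclideanSpace ℝ (Fin 3)) → (EuclideanSpace ℝ (Fin 3)))
    (t : ℝ) : IsClosed {x : EuclideanSpace ℝ (Fin 3) | IsBackwardSingularPoint u (t, x)} := by
  refine isOpen_compl_iff.1 (Metric.isOpen_iff.2 fun x hx => ?_)
  obtain ⟨r, hr, hfin⟩ : ∃ r : ℝ, 0 < r ∧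
      eLpNorm (Function.uncurry u) ∞
        (volume.restrict (parabolicCylinder r ((t, x) : ℝ × EuclideanSpace ℝ (Fin 3)))) ≠ ∞ := by
    by_contra hcon
    push Not at hcon
    exact hx fun r hr => hcon r hr
  refine ⟨r / 2, by positivity, fun x' hx' hsing => ?_⟩
  have hx'r : dist x' x < r / 2 := hx'
  have hsub : parabolicCylinder (r / 2) ((t, x') : ℝ × EuclideanSpace ℝ (Fin 3)) ⊆
      parabolicCylinder r ((t, x) : ℝ × EuclideanSpace ℝ (Fin 3)) := by
    intro z hz
    simp only [mem_parabolicCylinder] at hz ⊢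
    have hr2 : (r / 2) ^ 2 ≤ r ^ 2 := by nlinarith
    refine ⟨⟨by linarith [hz.1.1], hz.1.2⟩, ?_⟩
    calc dist z.2 x ≤ dist z.2 x' + dist x' x := dist_triangle _ _ _
      _ < r / 2 + r / 2 := add_lt_add hz.2 hx'r
      _ = r := by ring
  have hle := eLpNorm_mono_measure (p := ∞) (Function.uncurry u)
    (Measure.restrict_mono hsub (le_refl (volume : Measure (ℝ × EuclideanSpace ℝ (Fin 3)))))
  exact hfin (eq_top_iff.2 ((hsing (r / 2) (by positivity)).symm.le.trans hle))

/-- **The regular part of a slice with `ℋ¹`-null backward-singular set is path-connected** — nullity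
is the only hypothesis (closedness by `isClosed_backwardSingularSlice`). For the terminal slice of the
Clay-class solutions of D₁ the nullity is brick B0,
`hausdorffMeasure_terminal_backwardSingularSlice_eq_zero`
(`Theorems/RootDecompLitSliceDarkBallSpreadsTerminalSliceNullity.lean`), which plugs in directly.
[cite: CaffarelliKohnNirenberg1982, §6 Theorem B] [this file] -/
theorem isPathConnected_compl_backwardSingularSlice_of_hausdorffMeasure_eq_zero
    (u : ℝ → (EuclideanSpace ℝ (Fin 3)) → (EuclideanSpace ℝ (Fin 3))) (t : ℝ)
    (hnull : μH[1] {x : EuclideanSpace ℝ (Fin 3) | IsBackwardSingularPoint u (t, x)} = 0) :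
    IsPathConnected {x : EuclideanSpace ℝ (Fin 3) | IsBackwardSingularPoint u (t, x)}ᶜ :=
  isPathConnected_compl_of_isClosed_of_hausdorffMeasure_two_eq_zero (isClosed_backwardSingularSlice u t)
    (hausdorffMeasure_two_eq_zero_of_one hnull)

/-- Same with the sharp hypothesis `ℋ²(Σ_t) = 0`. [this file] -/
theorem isPathConnected_compl_backwardSingularSlice_of_hausdorffMeasure_two_eq_zero
    (u : ℝ → (EuclideanSpace ℝ (Fin 3)) → (EuclideanSpace ℝ (Fin 3))) (t : ℝ)
    (hnull : μH[2] {x : EuclideanSpace ℝ (Fin 3) | IsBackwardSingularPoint u (t, x)} = 0) :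
    IsPathConnected {x : EuclideanSpace ℝ (Fin 3) | IsBackwardSingularPoint u (t, x)}ᶜ :=
  isPathConnected_compl_of_isClosed_of_hausdorffMeasure_two_eq_zero (isClosed_backwardSingularSlice u t)
    hnull

/-- The regular part `Σ_tᶜ` of any slice is open. [this file] -/
theorem isOpen_compl_backwardSingularSlice
    (u : ℝ → (EuclideanSpace ℝ (Fin 3)) → (EuclideanSpace ℝ (Fin 3))) (t : ℝ) :
    IsOpen {x : EuclideanSpace ℝ (Fin 3) | IsBackwardSingularPoint u (t, x)}ᶜ :=
  (isClosed_backwardSingularSlice u t).isOpen_compl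

end Terminal

end Summit.NavierStokesRegularity.NavierStokesRegularity.Theorems
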